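import Literature.Computability.Complexity.TruthTableClosure
import Literature.Computability.Complexity.PlumbingBricks
import Literature.Computability.Complexity.FPStringBricks
import Literature.Computability.Complexity.UnaryArithMachines
import Literature.Computability.Complexity.IterateFPGrowth
import Literature.Computability.Complexity.BinarySubtraction
import HarnessLib

/-!
# Hash-check bricks: unary products, list items, `𝔽₂` inner products, popcount, and the block scan of Stockmeyer's estimator

Trunk `CplxCore`, toolkit in the "algebra of `FP` string functions" style (`comp_mem_FP`,
`fanoutFn`, `iteFn` on one-bit conditions, record projections `Brick.nthF`/`sndPow`, clocked loops
`iterate_mem_FP` / `iterate_mem_FP_of_growth`), assembled from existing bricks with **no new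
machine and no new transducer**. These are the string functions of the machine half of Stockmeyer's
approximate counting theorem (the named fact `stockmeyerApproxCounting`, `ApproximateCounting.lean`;
mathematics in `StockmeyerEstimator.lean`): the `NP^O` witness checker evaluates affine hashes
`h(y) = Ay + b` over `𝔽₂` row by row on a witness list, and the `FP^{NP^O}` transducer scans the
blocks of oracle answers for the first level with a `0` and writes `0ᵏ · count` in binary.

* `HashBricks.umulFn ⟨1ᵃ, 1ᵇ⟩ = 1^{ab}` (`UnaryArithMachines.mulFn` on the header `1ᵇ 0 1ᵃ 0`, middle
  field by `OracleCompose.midT`) — the offset `j (m+1)` of hash row `j`;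
* `HashBricks.nthItemFn ⟨1ʲ, W⟩` — item `j` of a nested-pair list (`|1ʲ|` second projections, then
  the first; `nthItemFn_body`: on `OracleCompose.body l` it is `l[j]`, `ε` past the end);
* `HashBricks.headBitFn w = [w.headD false]`, `xorFn` (one-bit), `andParityFn ⟨a, y⟩ =
  [parity of #{i | aᵢ ∧ yᵢ}]` (the `𝔽₂` inner product; a clocked loop `parRound` with the model
  `parModel`, `parModel_parity`), `popCountFn w = encodeNat #{i | wᵢ = 1}` (`cntRound`);
* the **block scan** `HashBricks.scanFn mS pc ⟨x', bits⟩`: with block length `T = |x'| + 1` and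
  `m = |mS x'|` levels, find the first `k ≤ m` whose block `blk bits T k` contains a `0` and output
  `outStr pc k block = 0ᵏ · pc block` (`ε` if `pc block = ε` or if there is no such level); state
  `st`, rounds `scanRound_cont` / `scanRound_stop` / `scanRound_done` / `scanRound_over`, the runs
  `iterate_scan_noStop` / `iterate_scan_stop` / `iterate_scan_none`, linear growth
  `length_scanRound_le` (the ruler `1ᵀ` is recomputed from the preserved header and junk fields are
  capped, so the bound holds on every string), `scanFn_mem_FP`, and the value `scanFn_apply` in terms
  of `firstZeroBlock`.

## References

* S. Arora, B. Barak, *Computational Complexity: A Modern Approach*, CUP 2009, §1.3 (polynomial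
  time is closed under composition and polynomially bounded loops; counters), §1.4.1 (clocked
  simulation), §0.1 (pairing).
-/

namespace Literature.Computability.Complexity

open _root_.Computability Polynomial Brick Plumb OracleCompose PRelSigma TTClosure

namespace HashBricks

/-! ### Unary multiplication `⟨1ᵃ, 1ᵇ⟩ ↦ 1^{ab}` -/

/-- The header `1ᵇ 0 1ᵃ 0` built from a pair `⟨u, v⟩` (`a = |u|`, `b = |v|`). [folklore] -/
noncomputable def mulHdrFn : List Bool → List Bool :=
  concatFn ∘ fanoutFn (onesFn ∘ sndF) (List.cons false ∘ concatFn ∘ fanoutFn (onesFn ∘ fstF) (fun _ => [false]))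

/-- `mulHdrFn z = hdr |sndF z| |fstF z| ε`. [folklore] -/
theorem mulHdrFn_apply (z : List Bool) : mulHdrFn z = hdr (sndF z).length (fstF z).length [] := by
  simp [mulHdrFn, hdr, onesFn, unaryEncodeNat_eq_replicate, ones]

/-- `mulHdrFn ∈ FP`. [folklore] -/
theorem mulHdrFn_mem_FP : mulHdrFn ∈ FP :=
  comp_mem_FP concatFn_mem_FP (fanoutFn_mem_FP (comp_mem_FP onesFn_mem_FP sndF_mem_FP)
    (comp_mem_FP (cons_mem_FP false) (comp_mem_FP concatFn_mem_FP
      (fanoutFn_mem_FP (comp_mem_FP onesFn_mem_FP fstF_mem_FP) (const_mem_FP _)))))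

/-- **Unary multiplication**: `umulFn ⟨u, v⟩ = 1^{|u|·|v|}` (the multiplication machine `mulFn` of
`UnaryArithMachines.lean` on the header `1^{|v|} 0 1^{|u|} 0`, then the middle field).
[Arora–Barak 2009, §1.3 (arithmetic on unary counters)] [folklore] -/
noncomputable def umulFn : List Bool → List Bool := midT.eval ∘ mulFn ∘ mulHdrFn

/-- `umulFn z = 1^{|fstF z| · |sndF z|}`. [folklore] -/
theorem umulFn_apply (z : List Bool) : umulFn z = ones ((fstF z).length * (sndF z).length) := by
  rw [umulFn, Function.comp_apply, Function.comp_apply, mulHdrFn_apply, mulFn_hdr, midT_eval_hdr]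

/-- `umulFn ⟨1ᵃ, 1ᵇ⟩ = 1^{ab}`. [folklore] -/
@[simp] theorem umulFn_boolPair (a b : ℕ) : umulFn (boolPair (ones a) (ones b)) = ones (a * b) := by
  rw [umulFn_apply, fstF_boolPair, sndF_boolPair, List.length_replicate, List.length_replicate]

/-- `umulFn ∈ FP`. [folklore] -/
theorem umulFn_mem_FP : umulFn ∈ FP :=
  comp_mem_FP midT.polyTimeComputable_eval (comp_mem_FP mulFn_mem_FP mulHdrFn_mem_FP)

/-! ### Random access in a nested-pair list: the `|u|`-th item -/

/-- One step of item dropping: `⟨u, W⟩ ↦ ⟨u, sndF W⟩`. [folklore] -/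
noncomputable def dropItemStep : List Bool → List Bool := fanoutFn fstF (sndF ∘ sndF)

/-- `dropItemStep ⟨u, W⟩ = ⟨u, sndF W⟩`. [folklore] -/
@[simp] theorem dropItemStep_boolPair (u W : List Bool) :
    dropItemStep (boolPair u W) = boolPair u (sndF W) := by
  simp [dropItemStep]

/-- `dropItemStep` does not lengthen its argument by more than `2`. [folklore] -/
theorem length_dropItemStep_le (w : List Bool) : (dropItemStep w).length ≤ w.length + 2 := by
  rw [dropItemStep, fanoutFn_apply, length_boolPair]
  have h1 := length_fstF_sndF_le w
  have h2 := length_fstF_sndF_le (sndF w)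
  simp only [Function.comp_apply]
  omega

/-- `dropItemStep ∈ FP`. [folklore] -/
theorem dropItemStep_mem_FP : dropItemStep ∈ FP :=
  fanoutFn_mem_FP fstF_mem_FP (comp_mem_FP sndF_mem_FP sndF_mem_FP)

/-- Iterating `dropItemStep`. [folklore] -/
theorem iterate_dropItemStep (u : List Bool) : ∀ (j : ℕ) (W : List Bool),
    dropItemStep^[j] (boolPair u W) = boolPair u (sndF^[j] W)
  | 0, W => rfl
  | j + 1, W => by
    rw [Function.iterate_succ_apply, dropItemStep_boolPair, iterate_dropItemStep u j,
      ← Function.iterate_succ_apply sndF]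

/-- **`nthItemFn ⟨u, W⟩`: the item of the nested-pair list `W` at position `|u|`** (first components
after `|u|` second projections; junk past the end). [Arora–Barak 2009, §1.3 (loops)] [folklore] -/
noncomputable def nthItemFn : List Bool → List Bool :=
  fstF ∘ sndF ∘ fun z => dropItemStep^[X.eval (boolUnpair z).1.length] z

/-- `nthItemFn ⟨u, W⟩ = fstF (sndF^{|u|} W)`. [folklore] -/
theorem nthItemFn_boolPair (u W : List Bool) :
    nthItemFn (boolPair u W) = fstF (sndF^[u.length] W) := by
  simp only [nthItemFn, Function.comp_apply, boolUnpair_boolPair, eval_X, iterate_dropItemStep,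
    sndF_boolPair]

/-- `nthItemFn ∈ FP`. [folklore] -/
theorem nthItemFn_mem_FP : nthItemFn ∈ FP :=
  comp_mem_FP fstF_mem_FP (comp_mem_FP sndF_mem_FP
    (iterate_mem_FP dropItemStep_mem_FP 2 length_dropItemStep_le X))

/-- `sndF ε = ε`. [folklore] -/
@[simp] theorem sndF_nil : sndF [] = [] := by simp [sndF, boolUnpair]

/-- `fstF ε = ε`. [folklore] -/
@[simp] theorem fstF_nil : fstF [] = [] := by simp [fstF, boolUnpair]

/-- Second projections walk down a coded list (`OracleCompose.body`: nested pairs). [folklore] -/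
theorem sndF_iterate_body : ∀ (j : ℕ) (l : List (List Bool)),
    sndF^[j] (body l) = body (l.drop j)
  | 0, l => rfl
  | j + 1, [] => by
    rw [Function.iterate_succ_apply, List.drop_nil, body_nil, sndF_nil]
    exact (sndF_iterate_body j []).trans (by simp)
  | j + 1, a :: l => by
    rw [Function.iterate_succ_apply, body_cons, sndF_boolPair, sndF_iterate_body j l]
    rfl

/-- The first projection of a coded list is its head (`ε` for the empty list). [folklore] -/
theorem fstF_body (l : List (List Bool)) : fstF (body l) = l.headD [] := by
  cases l with
  | nil => rw [body_nil, fstF_nil]; rfl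
  | cons a l => rw [body_cons, fstF_boolPair]; rfl

/-- **`nthItemFn ⟨1ʲ, body l⟩ = l[j]`** (`ε` past the end). [folklore] -/
theorem nthItemFn_body (j : ℕ) (l : List (List Bool)) :
    nthItemFn (boolPair (ones j) (body l)) = l.getD j [] := by
  rw [nthItemFn_boolPair, List.length_replicate, sndF_iterate_body, fstF_body,
    List.getD_eq_getElem?_getD]
  cases h : l.drop j with
  | nil =>
    rw [List.getElem?_eq_none (List.drop_eq_nil_iff.1 h)]
    rfl
  | cons a l' =>
    have : l[j]? = some a := by rw [← List.head?_drop, h]; rfl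
    rw [this]
    rfl

/-! ### One-bit tests -/

/-- The test "the string starts with `1`" as a one-bit string: `[w.headD false]`. [folklore] -/
noncomputable def headBitFn : List Bool → List Bool :=
  eqPairFn ∘ fanoutFn take1Fn (fun _ => [true])

/-- `headBitFn w = [w.headD false]`. [folklore] -/
@[simp] theorem headBitFn_apply (w : List Bool) : headBitFn w = [w.headD false] := by
  rw [headBitFn, Function.comp_apply, fanoutFn_apply, eqPairFn_boolPair]
  cases w with
  | nil => rfl
  | cons b w => cases b <;> rfl

/-- `headBitFn ∈ FP`. [folklore] -/
theorem headBitFn_mem_FP : headBitFn ∈ FP :=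
  comp_mem_FP eqPairFn_mem_FP (fanoutFn_mem_FP take1Fn_mem_FP (const_mem_FP _))

/-- `headBitFn` is one-bit. [folklore] -/
theorem oneBit_headBitFn : OneBit headBitFn := fun w => ⟨_, headBitFn_apply w⟩

/-- Exclusive or of two one-bit conditions as an `iteFn`. [folklore] -/
noncomputable def xorFn (c d : List Bool → List Bool) : List Bool → List Bool := iteFn d (notFn c) c

/-- `xorFn c d z = [xor b b']` when `c z = [b]`, `d z = [b']`. [folklore] -/
theorem xorFn_apply {c d : List Bool → List Bool} {z : List Bool} {b b' : Bool} (h : c z = [b])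
    (h' : d z = [b']) : xorFn c d z = [xor b b'] := by
  rw [xorFn, iteFn_apply h']
  cases b' <;> simp [h, notFn_apply h]

/-- `xorFn` of one-bit conditions is one-bit. [folklore] -/
theorem oneBit_xorFn {c d : List Bool → List Bool} (hc : OneBit c) (hd : OneBit d) : OneBit (xorFn c d) :=
  hd.ite (oneBit_notFn hc) hc

/-- `xorFn c d ∈ FP`. [folklore] -/
theorem xorFn_mem_FP {c d : List Bool → List Bool} (hc : c ∈ FP) (hd : d ∈ FP) : xorFn c d ∈ FP :=
  iteFn_mem_FP hd (notFn_mem_FP hc) hc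

/-! ### Parity of a bitwise `AND` -/

/-- State of the parity loop: `⟨a, ⟨y, acc⟩⟩`; one round consumes a bit of `a` and of `y` and
updates the parity bit `acc`. [folklore] -/
noncomputable def parBody : List Bool → List Bool :=
  fanoutFn (List.tail ∘ fstF) (fanoutFn (List.tail ∘ fstF ∘ sndF)
    (xorFn (headBitFn ∘ sndF ∘ sndF) (andFn (headBitFn ∘ fstF) (headBitFn ∘ fstF ∘ sndF))))

/-- One round of the parity loop. [folklore] -/
theorem parBody_apply (a y : List Bool) (acc : Bool) :
    parBody (boolPair a (boolPair y [acc])) =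
      boolPair a.tail (boolPair y.tail [xor acc (a.headD false && y.headD false)]) := by
  rw [parBody, fanoutFn_apply, fanoutFn_apply]
  have hc : (headBitFn ∘ sndF ∘ sndF) (boolPair a (boolPair y [acc])) = [acc] := by simp
  have hd : andFn (headBitFn ∘ fstF) (headBitFn ∘ fstF ∘ sndF) (boolPair a (boolPair y [acc])) =
      [a.headD false && y.headD false] :=
    andFn_apply (by simp) (by simp)
  rw [xorFn_apply hc hd]
  simp

/-- `parBody ∈ FP`. [folklore] -/
theorem parBody_mem_FP : parBody ∈ FP :=
  fanoutFn_mem_FP (comp_mem_FP tail_mem_FP fstF_mem_FP)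
    (fanoutFn_mem_FP (comp_mem_FP tail_mem_FP (comp_mem_FP fstF_mem_FP sndF_mem_FP))
      (xorFn_mem_FP (comp_mem_FP headBitFn_mem_FP (comp_mem_FP sndF_mem_FP sndF_mem_FP))
        (andFn_mem_FP (comp_mem_FP headBitFn_mem_FP fstF_mem_FP)
          (comp_mem_FP headBitFn_mem_FP (comp_mem_FP fstF_mem_FP sndF_mem_FP)))))

/-- The xor-and branch is one-bit on every input. [folklore] -/
theorem length_xorAnd_eq (z : List Bool) :
    (xorFn (headBitFn ∘ sndF ∘ sndF) (andFn (headBitFn ∘ fstF) (headBitFn ∘ fstF ∘ sndF)) z).length = 1 :=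
  (oneBit_xorFn (oneBit_headBitFn.comp (sndF ∘ sndF))
    (oneBit_andFn (oneBit_headBitFn.comp fstF) (oneBit_headBitFn.comp (fstF ∘ sndF)))).length_eq z

/-- `parBody` lengthens no input by more than `5`. [folklore] -/
theorem length_parBody_le (z : List Bool) : (parBody z).length ≤ z.length + 5 := by
  rw [parBody, fanoutFn_apply, fanoutFn_apply, length_boolPair, length_boolPair]
  have h1 := length_fstF_sndF_le z
  have h2 := length_fstF_sndF_le (sndF z)
  have h3 := length_xorAnd_eq z
  have h4 : (fstF z).tail.length ≤ (fstF z).length := by simp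
  have h5 : (fstF (sndF z)).tail.length ≤ (fstF (sndF z)).length := by simp
  simp only [Function.comp_apply] at *
  omega

/-- The parity loop on the full state `⟨clock, state⟩`. [folklore] -/
noncomputable def parRound : List Bool → List Bool := fanoutFn fstF (parBody ∘ sndF)

/-- `parRound ∈ FP`. [folklore] -/
theorem parRound_mem_FP : parRound ∈ FP :=
  fanoutFn_mem_FP fstF_mem_FP (comp_mem_FP parBody_mem_FP sndF_mem_FP)

/-- `parRound` lengthens no input by more than `7`. [folklore] -/
theorem length_parRound_le (w : List Bool) : (parRound w).length ≤ w.length + 7 := by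
  rw [parRound, fanoutFn_apply, length_boolPair]
  have h1 := length_fstF_sndF_le w
  have h2 := length_parBody_le (sndF w)
  simp only [Function.comp_apply] at *
  omega

/-- The mathematical model of the loop: the parity accumulated over `n` rounds. [folklore] -/
def parModel : List Bool → List Bool → Bool → ℕ → List Bool × List Bool × Bool
  | a, y, acc, 0 => (a, y, acc)
  | a, y, acc, n + 1 => parModel a.tail y.tail (xor acc (a.headD false && y.headD false)) n

/-- The loop realises the model. [folklore] -/
theorem iterate_parRound (r : List Bool) : ∀ (n : ℕ) (a y : List Bool) (acc : Bool),
    parRound^[n] (boolPair r (boolPair a (boolPair y [acc]))) =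
      boolPair r (boolPair (parModel a y acc n).1 (boolPair (parModel a y acc n).2.1
        [(parModel a y acc n).2.2]))
  | 0, a, y, acc => rfl
  | n + 1, a, y, acc => by
    rw [Function.iterate_succ_apply, parRound, fanoutFn_apply, fstF_boolPair, Function.comp_apply,
      sndF_boolPair, parBody_apply, ← parRound, iterate_parRound r n]
    rfl

/-- **The model computes the parity of the bitwise `AND`**, over `|y|` rounds. [folklore] -/
theorem parModel_parity : ∀ (y a : List Bool) (acc : Bool),
    (parModel a y acc y.length).2.2 = xor acc (decide (Odd ((a.zipWith (· && ·) y).count true)))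
  | [], a, acc => by simp [parModel]
  | b :: y, [], acc => by
    simp only [List.length_cons, parModel, List.tail_nil, List.tail_cons, List.headD_nil, Bool.false_and,
      Bool.xor_false]
    rw [parModel_parity y [] acc]
    simp
  | b :: y, c :: a, acc => by
    simp only [List.length_cons, parModel, List.tail_cons, List.headD_cons]
    rw [parModel_parity y a, List.zipWith_cons_cons, List.count_cons, Bool.xor_assoc]
    congr 1
    have key : ∀ (n : ℕ) (e : Bool), (e ^^ decide (Odd n)) = decide (Odd (n + if e = true then 1 else 0)) := by
      intro n e
      cases e
      · simp
      · by_cases h : Odd n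
        · have h' : ¬ Odd (n + 1) := fun h1 => (Nat.odd_add_one.1 h1) h
          simp [h, h']
        · have h' : Odd (n + 1) := Nat.odd_add_one.2 h
          simp [h, h']
    cases c <;> cases b <;> simp [key]

/-- Initial state `⟨y, ⟨a, ⟨y, [0]⟩⟩⟩` of the parity loop (clock `y`). [folklore] -/
noncomputable def parInit : List Bool → List Bool :=
  fanoutFn sndF (fanoutFn fstF (fanoutFn sndF (fun _ => [false])))

/-- **`andParityFn ⟨a, y⟩ = [parity of #{i | aᵢ ∧ yᵢ}]`** — the `𝔽₂` inner product of two bit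
strings as a one-bit string (a clocked loop of `|y|` rounds of `parBody`). [Arora–Barak 2009, §1.3
(loops)] [folklore] -/
noncomputable def andParityFn : List Bool → List Bool :=
  sndF ∘ sndF ∘ sndF ∘ (fun z => parRound^[X.eval (boolUnpair z).1.length] z) ∘ parInit

/-- Value of `andParityFn` on a pair. [folklore] -/
@[simp] theorem andParityFn_boolPair (a y : List Bool) :
    andParityFn (boolPair a y) = [decide (Odd ((a.zipWith (· && ·) y).count true))] := by
  have h := iterate_parRound y y.length a y false
  simp only [andParityFn, parInit, Function.comp_apply, fanoutFn_apply, fstF_boolPair, sndF_boolPair,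
    boolUnpair_boolPair, eval_X, h, parModel_parity, Bool.false_xor]

/-- `andParityFn ∈ FP`. [folklore] -/
theorem andParityFn_mem_FP : andParityFn ∈ FP :=
  comp_mem_FP sndF_mem_FP (comp_mem_FP sndF_mem_FP (comp_mem_FP sndF_mem_FP (comp_mem_FP
    (iterate_mem_FP parRound_mem_FP 7 length_parRound_le X)
    (fanoutFn_mem_FP sndF_mem_FP (fanoutFn_mem_FP fstF_mem_FP
      (fanoutFn_mem_FP sndF_mem_FP (const_mem_FP _)))))))

/-! ### The number of `1`s of a string, in binary -/

/-- Loop body of the counter: `⟨w, n⟩ ↦ ⟨tail w, n + [head w]⟩` (`n` a numeral). [folklore] -/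
noncomputable def cntBody : List Bool → List Bool :=
  fanoutFn (List.tail ∘ fstF) (iteFn (headBitFn ∘ fstF) (addFn ∘ fanoutFn sndF (fun _ => [true])) sndF)

/-- One round of the counter. [folklore] -/
theorem cntBody_apply (w : List Bool) (n : ℕ) :
    cntBody (boolPair w (encodeNat n)) =
      boolPair w.tail (encodeNat (n + if w.headD false then 1 else 0)) := by
  rw [cntBody, fanoutFn_apply]
  have hc : (headBitFn ∘ fstF) (boolPair w (encodeNat n)) = [w.headD false] := by simp
  rw [iteFn_apply hc]
  cases w.headD false <;> simp [bitsToNat_encodeNat]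

/-- `cntBody ∈ FP`. [folklore] -/
theorem cntBody_mem_FP : cntBody ∈ FP :=
  fanoutFn_mem_FP (comp_mem_FP tail_mem_FP fstF_mem_FP)
    (iteFn_mem_FP (comp_mem_FP headBitFn_mem_FP fstF_mem_FP)
      (comp_mem_FP addFn_mem_FP (fanoutFn_mem_FP sndF_mem_FP (const_mem_FP _))) sndF_mem_FP)

/-- `cntBody` lengthens no input by more than `3`. [folklore] -/
theorem length_cntBody_le (z : List Bool) : (cntBody z).length ≤ z.length + 3 := by
  rw [cntBody, fanoutFn_apply, length_boolPair]
  have h1 := length_fstF_sndF_le z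
  have h4 : ((List.tail ∘ fstF) z).length ≤ (fstF z).length := by simp
  obtain ⟨b, hb⟩ := (oneBit_headBitFn.comp fstF) z
  cases b
  · rw [iteFn_apply_false hb]; omega
  · rw [iteFn_apply_true hb]
    have hb1 : bitsToNat [true] = 1 := by rw [bitsToNat_cons, bitsToNat_nil]; rfl
    have h2 : (addFn (fanoutFn sndF (fun _ => [true]) z)).length ≤ (sndF z).length + 1 := by
      rw [fanoutFn_apply, addFn_boolPair, hb1]
      exact (length_encodeNat_succ_le (bitsToNat (sndF z))).trans
        (Nat.add_le_add_right (length_encodeNat_bitsToNat_le (sndF z)) 1)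
    have h6 : (addFn ∘ fanoutFn sndF fun _ => [true]) z = addFn (fanoutFn sndF (fun _ => [true]) z) :=
      Function.comp_apply
    rw [h6]
    omega

/-- The counter loop on the full state `⟨clock, state⟩`. [folklore] -/
noncomputable def cntRound : List Bool → List Bool := fanoutFn fstF (cntBody ∘ sndF)

/-- `cntRound ∈ FP`. [folklore] -/
theorem cntRound_mem_FP : cntRound ∈ FP :=
  fanoutFn_mem_FP fstF_mem_FP (comp_mem_FP cntBody_mem_FP sndF_mem_FP)

/-- `cntRound` lengthens no input by more than `5`. [folklore] -/
theorem length_cntRound_le (w : List Bool) : (cntRound w).length ≤ w.length + 5 := by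
  rw [cntRound, fanoutFn_apply, length_boolPair]
  have h1 := length_fstF_sndF_le w
  have h2 := length_cntBody_le (sndF w)
  simp only [Function.comp_apply] at *
  omega

/-- The loop counts the `1`s of the consumed prefix. [folklore] -/
theorem iterate_cntRound (r : List Bool) : ∀ (k : ℕ) (w : List Bool) (n : ℕ),
    cntRound^[k] (boolPair r (boolPair w (encodeNat n))) =
      boolPair r (boolPair (w.drop k) (encodeNat (n + (w.take k).count true)))
  | 0, w, n => by simp
  | k + 1, w, n => by
    rw [Function.iterate_succ_apply, cntRound, fanoutFn_apply, fstF_boolPair, Function.comp_apply,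
      sndF_boolPair, cntBody_apply, ← cntRound, iterate_cntRound r k]
    cases w with
    | nil => simp
    | cons b w => cases b <;> simp [Nat.add_assoc, Nat.add_comm 1]

/-- **`popCountFn w = encodeNat #{i | wᵢ = 1}`** — the number of `1`s, as a canonical binary numeral
(a clocked loop of `|w|` increments). [Arora–Barak 2009, §1.3 (counters)] [folklore] -/
noncomputable def popCountFn : List Bool → List Bool :=
  sndF ∘ sndF ∘ (fun z => cntRound^[X.eval (boolUnpair z).1.length] z) ∘
    fanoutFn id (fanoutFn id (fun _ => []))

/-- Value of `popCountFn`. [folklore] -/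
@[simp] theorem popCountFn_apply (w : List Bool) : popCountFn w = encodeNat (w.count true) := by
  have h := iterate_cntRound w w.length w 0
  rw [show encodeNat 0 = [] from rfl] at h
  simp only [popCountFn, Function.comp_apply, fanoutFn_apply, id, boolUnpair_boolPair, eval_X, h,
    sndF_boolPair, List.take_length, Nat.zero_add]

/-- `popCountFn ∈ FP`. [folklore] -/
theorem popCountFn_mem_FP : popCountFn ∈ FP :=
  comp_mem_FP sndF_mem_FP (comp_mem_FP sndF_mem_FP (comp_mem_FP
    (iterate_mem_FP cntRound_mem_FP 5 length_cntRound_le X)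
    (fanoutFn_mem_FP OracleCompose.id_mem_FP (fanoutFn_mem_FP OracleCompose.id_mem_FP (const_mem_FP _)))))

/-! ### Scanning answer blocks: the estimator as a string function

State `S = ⟨x', ⟨rest, ⟨zeros, ⟨done, res⟩⟩⟩⟩`: the preserved header `x'` (clock; `T = |x'| + 1` is
the block length), the unread answer bits, `0ᵏ` for the current level `k`, the stop latch, the
result. -/

section Scan

variable (mS : List Bool → List Bool) (pc : List Bool → List Bool)

/-- The ruler `1ᵀ`, `T = |x'| + 1`, recomputed from the header. [folklore] -/
noncomputable def rulerF : List Bool → List Bool := polyFn (X + 1) ∘ fstF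

/-- The current block: the first `T` unread answer bits. [folklore] -/
noncomputable def blockF : List Bool → List Bool := takeFn ∘ fanoutFn rulerF (nthF 1)

/-- Continue: drop the block, level `k ↦ k + 1`. [folklore] -/
noncomputable def contW : List Bool → List Bool :=
  fanoutFn (dropFn ∘ fanoutFn rulerF (nthF 1)) (fanoutFn (List.cons false ∘ nthF 2)
    (fanoutFn (fun _ => [false]) (sndPow 3)))

/-- Stop: latch, result `0ᵏ · pc(block)` (empty if the count is `0`; `0ᵏ` capped at `T` symbols, a
no-op on genuine states). [folklore] -/
noncomputable def stopW : List Bool → List Bool :=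
  fanoutFn (nthF 1) (fanoutFn (nthF 2) (fanoutFn (fun _ => [true])
    (iteFn (isNilFn ∘ pc ∘ blockF) (fun _ => [])
      (concatFn ∘ fanoutFn (takeFn ∘ fanoutFn rulerF (nthF 2)) (pc ∘ blockF)))))

/-- The level guard `[k ≤ m]`: `|zeros| ≤ |mS x'|`. [folklore] -/
noncomputable def levelOkF : List Bool → List Bool := lenLeFn X ∘ fanoutFn (mS ∘ fstF) (nthF 2)

/-- **One round of the scan.** Latched or past level `m`: no-op; block all ones: continue; else stop.
[folklore] -/
noncomputable def scanRound : List Bool → List Bool :=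
  fanoutFn fstF (iteFn (headBitFn ∘ nthF 3) sndF
    (iteFn (levelOkF mS) (iteFn ((hasBitT false).eval ∘ blockF) (stopW pc) contW) sndF))

variable {mS pc}

/-- `scanRound` preserves the header. [folklore] -/
theorem fstF_scanRound (S : List Bool) : fstF (scanRound mS pc S) = fstF S := by
  rw [scanRound, fanoutFn_apply, fstF_boolPair]

/-- `rulerF ⟨x', w⟩ = 1^{|x'|+1}`. [folklore] -/
@[simp] theorem rulerF_boolPair (x' w : List Bool) : rulerF (boolPair x' w) = ones (x'.length + 1) := by
  simp [rulerF]

/-- The ruler is as long as the header plus one. [folklore] -/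
theorem length_rulerF (S : List Bool) : (rulerF S).length = (fstF S).length + 1 := by
  simp [rulerF, ones]

/-- The block is at most `T` long. [folklore] -/
theorem length_blockF_le (S : List Bool) : (blockF S).length ≤ (fstF S).length + 1 := by
  rw [blockF, Function.comp_apply, fanoutFn_apply, takeFn_boolPair, length_rulerF]
  exact List.length_take_le _ _

/-- The block is a prefix of the unread bits. [folklore] -/
theorem length_blockF_le' (S : List Bool) : (blockF S).length ≤ (nthF 1 S).length := by
  rw [blockF, Function.comp_apply, fanoutFn_apply, takeFn_boolPair]
  exact List.length_take_le' _ _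

/-- Field sizes of a four-field record. [folklore] -/
theorem fields_le (w : List Bool) :
    2 * ((nthF 0 w).length + (nthF 1 w).length + (nthF 2 w).length) + (sndPow 2 w).length ≤ w.length := by
  have h0 := length_fstF_sndF_le w
  have h1 := length_fstF_sndF_le (sndF w)
  have h2 := length_fstF_sndF_le (sndF (sndF w))
  simp only [nthF, sndPow, Function.comp_apply] at *
  omega

/-- **Linear growth of the scan**: `|scanRound S| ≤ |S| + 12 (|x'| + 1)` provided
`|pc w| ≤ |w|`. [folklore] -/
theorem length_scanRound_le (hpc : ∀ w, (pc w).length ≤ w.length) (S : List Bool) :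
    (scanRound mS pc S).length ≤ S.length + 12 * ((boolUnpair S).1.length + 1) := by
  have hS := length_fstF_sndF_le S
  have hT := length_blockF_le S
  have hf := fields_le (sndF S)
  rw [scanRound, fanoutFn_apply, length_boolPair]
  change 2 * (fstF S).length + 2 + _ ≤ S.length + 12 * ((fstF S).length + 1)
  obtain ⟨b₁, hb₁⟩ := (oneBit_headBitFn.comp (nthF 3)) S
  cases b₁
  swap
  · rw [iteFn_apply_true hb₁]; omega
  rw [iteFn_apply_false hb₁]
  rcases lenLeFn_eq_or X (fanoutFn (mS ∘ fstF) (nthF 2) S) with hb₂ | hb₂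
  swap
  · rw [iteFn_apply_false (show levelOkF mS S = [false] from hb₂)]; omega
  rw [iteFn_apply_true (show levelOkF mS S = [true] from hb₂)]
  have hb₃ : ((hasBitT false).eval ∘ blockF) S = [decide (false ∈ blockF S)] := hasBitT_eval _ _
  -- field identities between `S` and `sndF S`
  have e1 : nthF 1 S = nthF 0 (sndF S) := rfl
  have e2 : nthF 2 S = nthF 1 (sndF S) := rfl
  have e3 : sndPow 3 S = sndPow 2 (sndF S) := rfl
  cases hfb : decide (false ∈ blockF S)
  · rw [hfb] at hb₃
    rw [iteFn_apply_false hb₃, contW, fanoutFn_apply, fanoutFn_apply, fanoutFn_apply, length_boolPair,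
      length_boolPair, length_boolPair]
    have hd : (dropFn ∘ fanoutFn rulerF (nthF 1)) S = (nthF 1 S).drop (rulerF S).length := by
      simp [dropFn_boolPair]
    rw [hd, e1, e3]
    simp only [Function.comp_apply, List.length_cons, List.length_nil, List.length_drop] at *
    rw [e2]
    omega
  · rw [hfb] at hb₃
    rw [iteFn_apply_true hb₃, stopW, fanoutFn_apply, fanoutFn_apply, fanoutFn_apply, length_boolPair,
      length_boolPair, length_boolPair]
    have hout : (iteFn (isNilFn ∘ pc ∘ blockF) (fun _ => [])
        (concatFn ∘ fanoutFn (takeFn ∘ fanoutFn rulerF (nthF 2)) (pc ∘ blockF)) S).length ≤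
        2 * ((fstF S).length + 1) := by
      have hnil : (isNilFn ∘ pc ∘ blockF) S = [decide (pc (blockF S) = [])] := rfl
      cases hb : decide (pc (blockF S) = [])
      · rw [hb] at hnil
        rw [iteFn_apply_false hnil]
        simp only [Function.comp_apply, fanoutFn_apply, concatFn_boolPair, takeFn_boolPair,
          List.length_append, List.length_take, length_rulerF]
        have := hpc (blockF S)
        omega
      · rw [hb] at hnil
        rw [iteFn_apply_true hnil]; simp
    rw [e1, e2]
    simp only [List.length_singleton] at *
    omega

/-- `contW ∈ FP`. [folklore] -/
theorem contW_mem_FP : contW ∈ FP :=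
  fanoutFn_mem_FP (comp_mem_FP dropFn_mem_FP (fanoutFn_mem_FP
      (comp_mem_FP (polyFn_mem_FP _) fstF_mem_FP) (nthF_mem_FP 1)))
    (fanoutFn_mem_FP (comp_mem_FP (cons_mem_FP false) (nthF_mem_FP 2))
      (fanoutFn_mem_FP (const_mem_FP _) (sndPow_mem_FP 3)))

/-- `blockF ∈ FP`. [folklore] -/
theorem blockF_mem_FP : blockF ∈ FP :=
  comp_mem_FP takeFn_mem_FP (fanoutFn_mem_FP (comp_mem_FP (polyFn_mem_FP _) fstF_mem_FP) (nthF_mem_FP 1))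

/-- `stopW pc ∈ FP` for `pc ∈ FP`. [folklore] -/
theorem stopW_mem_FP (hpc : pc ∈ FP) : stopW pc ∈ FP :=
  fanoutFn_mem_FP (nthF_mem_FP 1) (fanoutFn_mem_FP (nthF_mem_FP 2) (fanoutFn_mem_FP (const_mem_FP _)
    (iteFn_mem_FP (comp_mem_FP isNilFn_mem_FP (comp_mem_FP hpc blockF_mem_FP)) (const_mem_FP _)
      (comp_mem_FP concatFn_mem_FP (fanoutFn_mem_FP
        (comp_mem_FP takeFn_mem_FP (fanoutFn_mem_FP (comp_mem_FP (polyFn_mem_FP _) fstF_mem_FP)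
          (nthF_mem_FP 2))) (comp_mem_FP hpc blockF_mem_FP))))))

/-- `scanRound ∈ FP` for `mS, pc ∈ FP`. [folklore] -/
theorem scanRound_mem_FP (hmS : mS ∈ FP) (hpc : pc ∈ FP) : scanRound mS pc ∈ FP :=
  fanoutFn_mem_FP fstF_mem_FP (iteFn_mem_FP (comp_mem_FP headBitFn_mem_FP (nthF_mem_FP 3)) sndF_mem_FP
    (iteFn_mem_FP (comp_mem_FP (lenLeFn_mem_FP X) (fanoutFn_mem_FP (comp_mem_FP hmS fstF_mem_FP)
      (nthF_mem_FP 2)))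
      (iteFn_mem_FP (comp_mem_FP (hasBitT false).polyTimeComputable_eval blockF_mem_FP)
        (stopW_mem_FP hpc) contW_mem_FP) sndF_mem_FP))

/-- **The clocked scan is in `FP`**: `S ↦ scanRound^{|x'|+1} S`. [Arora–Barak 2009, §1.3 (loops)]
[folklore] -/
theorem iterate_scanRound_mem_FP (hmS : mS ∈ FP) (hpc : pc ∈ FP) (hlen : ∀ w, (pc w).length ≤ w.length) :
    (fun S => (scanRound mS pc)^[(X + 1).eval (boolUnpair S).1.length] S) ∈ FP :=
  iterate_mem_FP_of_growth (scanRound_mem_FP hmS hpc) 12 (fun S => fstF_scanRound S)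
    (length_scanRound_le hlen) (X + 1)

end Scan

section ScanSpec

variable (mS : List Bool → List Bool) (pc : List Bool → List Bool)

/-- Block `k` of the answer bits: the `T` bits from position `kT`. [folklore] -/
def blk (bits : List Bool) (T k : ℕ) : List Bool := (bits.drop (k * T)).take T

/-- The genuine states of the scan: `⟨x', ⟨rest, ⟨0ᵏ, ⟨[done], res⟩⟩⟩⟩`. [folklore] -/
def st (x' rest : List Bool) (k : ℕ) (done : Bool) (res : List Bool) : List Bool :=
  boolPair x' (boolPair rest (boolPair (List.replicate k false) (boolPair [done] res)))

/-- The result string written at a stop at level `k` on the block `b`. [folklore] -/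
def outStr (k : ℕ) (b : List Bool) : List Bool :=
  if pc b = [] then [] else List.replicate k false ++ pc b

variable {mS pc}

/-- Accessors on genuine states. [folklore] -/
theorem st_fields (x' rest : List Bool) (k : ℕ) (done : Bool) (res : List Bool) :
    fstF (st x' rest k done res) = x' ∧ nthF 1 (st x' rest k done res) = rest ∧
      nthF 2 (st x' rest k done res) = List.replicate k false ∧
      nthF 3 (st x' rest k done res) = [done] ∧ sndPow 3 (st x' rest k done res) = res ∧
      sndF (st x' rest k done res) = boolPair rest (boolPair (List.replicate k false) (boolPair [done] res)) := by
  simp [st, nthF, sndPow]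

/-- The block read in a genuine state. [folklore] -/
theorem blockF_st (x' rest : List Bool) (k : ℕ) (done : Bool) (res : List Bool) :
    blockF (st x' rest k done res) = rest.take (x'.length + 1) := by
  obtain ⟨h0, h1, -⟩ := st_fields x' rest k done res
  rw [blockF, Function.comp_apply, fanoutFn_apply, h1, takeFn_boolPair, rulerF, Function.comp_apply, h0,
    polyFn_apply, List.length_replicate]
  simp

/-- A latched state is fixed. [folklore] -/
theorem scanRound_done (x' rest : List Bool) (k : ℕ) (res : List Bool) :
    scanRound mS pc (st x' rest k true res) = st x' rest k true res := by
  obtain ⟨h0, h1, h2, h3, h4, h5⟩ := st_fields x' rest k true res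
  have hc : (headBitFn ∘ nthF 3) (st x' rest k true res) = [true] := by
    rw [Function.comp_apply, h3, headBitFn_apply]; rfl
  rw [scanRound, fanoutFn_apply, h0, iteFn_apply_true hc, h5]; rfl

/-- The level guard on a genuine state. [folklore] -/
theorem levelOkF_st (x' rest : List Bool) (k : ℕ) (done : Bool) (res : List Bool) :
    levelOkF mS (st x' rest k done res) = [decide (k ≤ (mS x').length)] := by
  obtain ⟨h0, h1, h2, -⟩ := st_fields x' rest k done res
  rw [levelOkF, Function.comp_apply, fanoutFn_apply, Function.comp_apply, h0, h2, lenLeFn_boolPair,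
    List.length_replicate, eval_X]

/-- Past level `m` an unlatched state is fixed. [folklore] -/
theorem scanRound_over (x' rest : List Bool) {k : ℕ} (hk : (mS x').length < k) (res : List Bool) :
    scanRound mS pc (st x' rest k false res) = st x' rest k false res := by
  obtain ⟨h0, h1, h2, h3, h4, h5⟩ := st_fields x' rest k false res
  have hc : (headBitFn ∘ nthF 3) (st x' rest k false res) = [false] := by
    rw [Function.comp_apply, h3, headBitFn_apply]; rfl
  have hg : levelOkF mS (st x' rest k false res) = [false] := by
    rw [levelOkF_st, decide_eq_false (Nat.not_le.2 hk)]
  rw [scanRound, fanoutFn_apply, h0, iteFn_apply_false hc, iteFn_apply_false hg, h5]; rfl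

/-- **Continue**: an all-ones block is consumed and the level increases. [folklore] -/
theorem scanRound_cont (x' rest : List Bool) {k : ℕ} (hk : k ≤ (mS x').length) (res : List Bool)
    (hb : false ∉ rest.take (x'.length + 1)) :
    scanRound mS pc (st x' rest k false res) = st x' (rest.drop (x'.length + 1)) (k + 1) false res := by
  obtain ⟨h0, h1, h2, h3, h4, h5⟩ := st_fields x' rest k false res
  have hc : (headBitFn ∘ nthF 3) (st x' rest k false res) = [false] := by
    rw [Function.comp_apply, h3, headBitFn_apply]; rfl
  have hg : levelOkF mS (st x' rest k false res) = [true] := by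
    rw [levelOkF_st, decide_eq_true hk]
  have hf : ((hasBitT false).eval ∘ blockF) (st x' rest k false res) = [false] := by
    rw [Function.comp_apply, hasBitT_eval, blockF_st, decide_eq_false hb]
  rw [scanRound, fanoutFn_apply, h0, iteFn_apply_false hc, iteFn_apply_true hg, iteFn_apply_false hf,
    contW, fanoutFn_apply, fanoutFn_apply, fanoutFn_apply, Function.comp_apply, fanoutFn_apply,
    h1, dropFn_boolPair, rulerF, Function.comp_apply, h0, polyFn_apply, Function.comp_apply, h2, h4]
  simp [st, ones, List.replicate_succ]

/-- **Stop**: at a block containing a `0` the scan latches and writes the result. [folklore] -/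
theorem scanRound_stop (x' rest : List Bool) {k : ℕ} (hk : k ≤ (mS x').length)
    (hkT : k ≤ x'.length + 1) (res : List Bool) (hb : false ∈ rest.take (x'.length + 1)) :
    scanRound mS pc (st x' rest k false res) =
      boolPair x' (boolPair rest (boolPair (List.replicate k false)
        (boolPair [true] (outStr pc k (rest.take (x'.length + 1)))))) := by
  obtain ⟨h0, h1, h2, h3, h4, h5⟩ := st_fields x' rest k false res
  have hc : (headBitFn ∘ nthF 3) (st x' rest k false res) = [false] := by
    rw [Function.comp_apply, h3, headBitFn_apply]; rfl
  have hg : levelOkF mS (st x' rest k false res) = [true] := by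
    rw [levelOkF_st, decide_eq_true hk]
  have hblk := blockF_st x' rest k false res
  have hf : ((hasBitT false).eval ∘ blockF) (st x' rest k false res) = [true] := by
    rw [Function.comp_apply, hasBitT_eval, hblk, decide_eq_true hb]
  have hnil : (isNilFn ∘ pc ∘ blockF) (st x' rest k false res) =
      [decide (pc (rest.take (x'.length + 1)) = [])] := by
    rw [Function.comp_apply, Function.comp_apply, hblk]; rfl
  have hout : iteFn (isNilFn ∘ pc ∘ blockF) (fun _ => [])
      (concatFn ∘ fanoutFn (takeFn ∘ fanoutFn rulerF (nthF 2)) (pc ∘ blockF)) (st x' rest k false res) =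
      outStr pc k (rest.take (x'.length + 1)) := by
    rw [outStr]
    by_cases hp : pc (rest.take (x'.length + 1)) = []
    · rw [decide_eq_true hp] at hnil
      rw [iteFn_apply_true hnil, if_pos hp]
    · rw [decide_eq_false hp] at hnil
      rw [iteFn_apply_false hnil, if_neg hp, Function.comp_apply, fanoutFn_apply, concatFn_boolPair,
        Function.comp_apply, fanoutFn_apply, takeFn_boolPair, rulerF, Function.comp_apply, h0, polyFn_apply,
        Function.comp_apply, hblk, h2]
      simp [ones, List.take_replicate]
      omega
  rw [scanRound, fanoutFn_apply, h0, iteFn_apply_false hc, iteFn_apply_true hg, iteFn_apply_true hf,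
    stopW, fanoutFn_apply, fanoutFn_apply, fanoutFn_apply, h1, h2, hout]

/-- Blocks of the unread bits are blocks of all bits. [folklore] -/
theorem take_drop_mul (bits : List Bool) (T j : ℕ) :
    (bits.drop (j * T)).take T = blk bits T j := rfl

/-- **The scan without a stop**: after `j ≤ m + 1` all-ones blocks the state is at level `j`.
[folklore] -/
theorem iterate_scan_noStop (x' bits : List Bool) :
    ∀ j : ℕ, j ≤ (mS x').length + 1 → (∀ k < j, false ∉ blk bits (x'.length + 1) k) →
      (scanRound mS pc)^[j] (st x' bits 0 false []) = st x' (bits.drop (j * (x'.length + 1))) j false []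
  | 0, _, _ => by simp
  | j + 1, hj, hall => by
    rw [Function.iterate_succ_apply', iterate_scan_noStop x' bits j (by omega) (fun k hk => hall k (by omega)),
      scanRound_cont x' _ (by omega) [] (hall j (by omega))]
    have : (bits.drop (j * (x'.length + 1))).drop (x'.length + 1) = bits.drop ((j + 1) * (x'.length + 1)) := by
      rw [List.drop_drop]; congr 1; ring
    rw [this]

/-- **The scan with a stop at level `k`.** [folklore] -/
theorem iterate_scan_stop (x' bits : List Bool) {k : ℕ} (hk : k ≤ (mS x').length)
    (hkT : k ≤ x'.length + 1) (hb : false ∈ blk bits (x'.length + 1) k)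
    (hall : ∀ k' < k, false ∉ blk bits (x'.length + 1) k') :
    ∀ n : ℕ, k + 1 ≤ n → (scanRound mS pc)^[n] (st x' bits 0 false []) =
      boolPair x' (boolPair (bits.drop (k * (x'.length + 1))) (boolPair (List.replicate k false)
        (boolPair [true] (outStr pc k (blk bits (x'.length + 1) k)))))
  | 0, h => absurd h (by omega)
  | n + 1, h => by
    rcases Nat.eq_or_lt_of_le h with h | h
    · rw [show n = k by omega, Function.iterate_succ_apply',
        iterate_scan_noStop x' bits k (by omega) hall, scanRound_stop x' _ hk hkT [] hb]
      rfl
    · rw [Function.iterate_succ_apply', iterate_scan_stop x' bits hk hkT hb hall n (by omega)]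
      exact scanRound_done x' _ k _

/-- **The scan with no `0` in any block** stays unlatched (with empty result). [folklore] -/
theorem iterate_scan_none (x' bits : List Bool)
    (hall : ∀ k ≤ (mS x').length, false ∉ blk bits (x'.length + 1) k) :
    ∀ n : ℕ, (mS x').length + 1 ≤ n → (scanRound mS pc)^[n] (st x' bits 0 false []) =
      st x' (bits.drop (((mS x').length + 1) * (x'.length + 1))) ((mS x').length + 1) false []
  | 0, h => absurd h (by omega)
  | n + 1, h => by
    rcases Nat.eq_or_lt_of_le h with h | h
    · rw [show n + 1 = (mS x').length + 1 by omega]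
      exact iterate_scan_noStop x' bits _ le_rfl (fun k hk => hall k (by omega))
    · rw [Function.iterate_succ_apply', iterate_scan_none x' bits hall n (by omega)]
      exact scanRound_over x' _ (by omega) []

/-! ### The estimator string function -/

variable (mS pc)

/-- Initial state `⟨x', ⟨bits, ⟨ε, ⟨[0], ε⟩⟩⟩⟩` from the input `⟨x', bits⟩`. [folklore] -/
noncomputable def scanInit : List Bool → List Bool :=
  fanoutFn fstF (fanoutFn sndF (fanoutFn (fun _ => []) (fanoutFn (fun _ => [false]) (fun _ => []))))

/-- Final output: the result if latched, `ε` otherwise. [folklore] -/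
noncomputable def scanOut : List Bool → List Bool := iteFn (headBitFn ∘ nthF 3) (sndPow 3) (fun _ => [])

/-- **The estimator as a string function** `⟨x', bits⟩ ↦ 0ᵏ pc(block k)` for the first level
`k ≤ m = |mS x'|` whose block (of length `T = |x'| + 1`) contains a `0` (`ε` if none, or if the
count is `0`) — a clocked scan of `T ≥ m + 1` rounds. [folklore] -/
noncomputable def scanFn : List Bool → List Bool :=
  scanOut ∘ (fun S => (scanRound mS pc)^[(X + 1).eval (boolUnpair S).1.length] S) ∘ scanInit

variable {mS pc}

/-- `scanFn ∈ FP`. [Arora–Barak 2009, §1.3 (clocked loops)] [folklore] -/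
theorem scanFn_mem_FP (hmS : mS ∈ FP) (hpc : pc ∈ FP) (hlen : ∀ w, (pc w).length ≤ w.length) :
    scanFn mS pc ∈ FP :=
  comp_mem_FP (iteFn_mem_FP (comp_mem_FP headBitFn_mem_FP (nthF_mem_FP 3)) (sndPow_mem_FP 3)
    (const_mem_FP _)) (comp_mem_FP (iterate_scanRound_mem_FP hmS hpc hlen)
    (fanoutFn_mem_FP fstF_mem_FP (fanoutFn_mem_FP sndF_mem_FP (fanoutFn_mem_FP (const_mem_FP _)
      (fanoutFn_mem_FP (const_mem_FP _) (const_mem_FP _))))))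

/-- The first level `k ≤ m` whose block contains a `0`. [folklore] -/
def firstZeroBlock (bits : List Bool) (T m : ℕ) : Option ℕ :=
  (List.range (m + 1)).find? fun k => decide (false ∈ blk bits T k)

/-- **Value of `scanFn`**, provided `|mS x'| ≤ |x'|`: the result string of the first block with a
`0`, or `ε`. [folklore] -/
theorem scanFn_apply (x' bits : List Bool) (hm : (mS x').length ≤ x'.length) :
    scanFn mS pc (boolPair x' bits) =
      match firstZeroBlock bits (x'.length + 1) (mS x').length with
      | none => []
      | some k => outStr pc k (blk bits (x'.length + 1) k) := by
  have hinit : scanInit (boolPair x' bits) = st x' bits 0 false [] := by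
    simp [scanInit, st]
  rw [scanFn, Function.comp_apply, Function.comp_apply, hinit]
  have hx : (boolUnpair (st x' bits 0 false [])).1 = x' := by simp [st]
  rw [hx, eval_add, eval_X, eval_one]
  cases hf : firstZeroBlock bits (x'.length + 1) (mS x').length with
  | none =>
    have hall : ∀ k ≤ (mS x').length, false ∉ blk bits (x'.length + 1) k := by
      intro k hk
      have := (List.find?_eq_none.1 hf) k (List.mem_range.2 (by omega))
      simpa using this
    rw [iterate_scan_none x' bits hall (x'.length + 1) (by omega)]
    obtain ⟨-, -, -, h3, -⟩ := st_fields x' (bits.drop (((mS x').length + 1) * (x'.length + 1)))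
      ((mS x').length + 1) false []
    have hc : (headBitFn ∘ nthF 3) (st x' (bits.drop (((mS x').length + 1) * (x'.length + 1)))
        ((mS x').length + 1) false []) = [false] := by
      rw [Function.comp_apply, h3, headBitFn_apply]; rfl
    simp only [scanOut, iteFn_apply_false hc]
  | some k =>
    obtain ⟨hk1, hk2, hk3⟩ := List.find?_range_eq_some.1 hf
    have hb : false ∈ blk bits (x'.length + 1) k := by simpa using hk1
    have hk : k ≤ (mS x').length := by have := List.mem_range.1 hk2; omega
    have hall : ∀ k' < k, false ∉ blk bits (x'.length + 1) k' := fun k' hk' => by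
      simpa using hk3 k' hk'
    rw [iterate_scan_stop x' bits hk (by omega) hb hall (x'.length + 1) (by omega)]
    have hc : (headBitFn ∘ nthF 3) (boolPair x' (boolPair (bits.drop (k * (x'.length + 1)))
        (boolPair (List.replicate k false) (boolPair [true] (outStr pc k (blk bits (x'.length + 1) k)))))) =
        [true] := by simp [nthF]
    simp only [scanOut, iteFn_apply_true hc]
    simp [sndPow]

end ScanSpec

end HashBricks

end Literature.Computability.Complexity
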